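import Mathlib
import HarnessLib
import Literature.MathematicalPhysics.QuantumLattice.KohnLuttinger
import Literature.MathematicalPhysics.QuantumLattice.HubbardEffectiveActionCT
import Literature.MathematicalPhysics.QuantumLattice.FermiRG.BGM2006Sec2Setup
import Literature.MathematicalPhysics.QuantumLattice.FermiRG.FST2Hypotheses

/-!
# Route `KLProgramme` — vocabulary of DECOMP C4a «DispersionFlow»: the KL-regime inductive invariant (I_h)
# for the scale-dependent dispersion (cell gate-hubbard-kl, seat p2; crux K3 = `KLRegimeTwoPointLimit`,
# stmt-HubbardSuperconductivity-19937; the intended statement of K3's child 2 `KLRegimeDispersionFlow`)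

Benfatto–Giuliani–Mastropietro 2006 (BGM06, arXiv:cond-mat/0507686) run their multiscale integration with a
SCALE-DEPENDENT dispersion `E_h` under the inductive hypothesis (2.36) — typed in the tree, on the carrier
`E : ℤ → ℝ × (Fin 2 → ℝ) → ℂ`, as `FermiRG.BGMSmoothness` (typer file `FermiRG/BGM2006Sec2Setup`):
`|E_h - E_{h-1}| ≤ C₀|U||h|γ^{2h}`, `|∂ⁿ(E_h - E_{h-1})| ≤ Cₙ|U|²|h|γ^{(2-n)h}`.  The factor `|h|` is harmless in
BGM's regime `|h| ≤ c₀/|U|` but in the Kohn–Luttinger regime of K3 (`U²|h_β| log γ ≤ c`) the zeroth-order line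
would not even stay bounded; DECOMP App. D traced every `|h|` to the sign-blind scale sums (3.70), (3.76)–(3.77),
and crux C4a is the `|h|`-FREE replacement.  Crux C4b / DECOMP App. C (confirmed by seat p2's kit job j247717 to
`10⁻³`, HOME/P2-C4B.md) says what happens at second order: at the eight umklapp corners of the Fermi curve the
TANGENTIAL second derivative of the cumulative correction grows like `+2Bα²U²|h| log γ`, `B = 1/(32√3π³κ(p₁)v(p₁)) > 0`
— one `log γ` per scale, no summable gain, CONVEXITY-ENHANCING sign — and is `O(U²)` elsewhere.

This file NAMES the resulting invariant (I_h) (P2-C4B §5 / DECOMP v7 §2 C4a) — predicates only, nothing asserted,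
nothing but `rfl`-bookkeeping proved (consequences: `KLProgrammeDispersionFlowEnvelope.lean`):

* on BGM's carrier `E` (the scheme of (2.36) and App. D): `IncrementBounds β U C w hβ E` = the bound clauses of
  `BGMSmoothness` with a general scale weight `w h` in place of `|h|` (`w = |·|`: the printed form,
  `bgmSmoothness_iff`; `w ≡ 1`: the `|h|`-free KL form); `effDisp`/`effLevel` = the effective dispersion `ε_h`
  (2.36c) read on `Momentum = EuclideanSpace ℝ (Fin 2)`, where FST II's `gradient`/`hessQuad`/`GeomConstants`
  live; `EffectiveStepBounds` = the per-scale `C⁰/C¹/C²` bounds of `ε_h - ε_{h-1}` in operator-norm form (what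
  Lemma 2.1 consumes); `TangentialFloor` = the ONE new clause: the CUMULATIVE correction `ε_h - ε_0` has tangential
  Hessian `≥ -bU²|t|²` along the scale-`h` level curves on the tube `{|ε_0 - μ| ≤ ē}`, uniformly in `h` (data:
  the minimum over the curve of `∂²_σReΣ₂/U²` is `-1.03·10⁻³` at `μ = -0.43`, `-1.24·10⁻³` at `μ = -0.18`, the SAME
  at `T = 2⁻⁶ … 2⁻¹²`, while the maximum grows like `2Bα² log(1/T)`); the package `KLDispersionFlow` and the regime
  `IsKLRegime U c h` (`U²|h| log 4 ≤ c`);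
* on the counterterm FRAME of the cell's model-bound carrier (`hubbardEffectiveActionCT … K Λ`, eng's D1
  `KLProgrammeSectorisedLegKernelsDefs`: the interacting band is `e_K = ε - μ - K`, `K : TrigPolyC4v`; in that
  scheme the dispersion "flow" down to `h_β` IS the frame `K` exhibited for `β`): `frameLevel μ K` = `e_K` on
  `Momentum` and `FrameGeometry U a₀ a₁ A b ē μ K` = the cumulative form of (I_h) at `h = h_β` for `D = -K`
  (`|K| ≤ a₀`, `‖∇K‖ ≤ a₁`, `‖D²K‖ ≤ A` — `A` may grow like `U²|h_β|` — and the tangential floor `-b`);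
* the SHAPES of K3's child 2 in either scheme, over the objects their schemes still owe:
  `KLRegimeDispersionFlowOf Efam` (BGM scheme: `Efam β L U μ` = the model's dispersion family, a D1′ request) and
  `KLRegimeFrameGeometryOf Adm` (CT scheme: `Adm β L U μ K` = "`K` is an admissible frame at these data", i.e.
  the renormalisation condition of the engine — to be supplied with the localisation operator on D1's
  `klSelfEnergy`; WITHOUT it a frame-geometry statement would be vacuous at `K = 0`, so the shape is conditional
  on `Adm` by design).

Deliberately NOT here: the second-order self-energy object `Σ₂` (DECOMP's candidate D4) — (I_h) is stated in
ENVELOPE form; the explicit corner profile `2B_hα_h²Λ_γ` is a device of C4a's proof, not of its statement.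
`γ = 4` written `4`, as in the typer files.  No `sorry`, no axioms, no instances, no notation.

References: BGM06 §2.3–2.4 (2.36), (2.36c), (2.41a), Lemma 2.1 [BenfattoGiulianiMastropietro2006]; FST II §2
[FeldmanSalmhoferTrubowitz1998]; FST 1996 (the frame `E = e + K`) [FeldmanSalmhoferTrubowitz1996]; HOME/DECOMP.md v7
§2 C4a/C4b, App. C, App. D; HOME/P2-C4B.md §5, §3.
-/

noncomputable section

namespace Summit.HubbardSuperconductivity.HubbardSuperconductivity.Theorems.DispersionFlow

set_option linter.dupNamespace false -- summit = problem name (single-conjunct summit), D-0017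

open Real
open Literature.MathematicalPhysics.QuantumLattice Literature.MathematicalPhysics.QuantumLattice.FermiRG

/-! ### BGM's carrier: (2.36) with a general scale weight -/

/-- **(2.36) with a scale weight `w`** (formal `L = ∞` form; the bound clauses of the tree's `FermiRG.BGMSmoothness`
with the printed factor `|h|` replaced by `w h`, same binders): for `h_β ≤ h ≤ 0`, `k₀ ∈ D_β`, `k⃗ ∈ ℝ²`,
`|E_h(k) - E_{h-1}(k)| ≤ C₀|U|w(h)γ^{2h}` and, for `a + b ≥ 1`,
`|∂_{k₀}^a∂_{k_{i₁}}⋯∂_{k_{i_b}}(E_h - E_{h-1})(k)| ≤ C_{a+b}|U|²w(h)γ^{(2-a-b)h}`.  `w = |·|` is BGM's hypothesis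
(`bgmSmoothness_iff`); `w ≡ 1` is the `|h|`-FREE form of crux C4a (gain `γ^h` at first order, NO gain and no `|h|`
at second order, the sector-compatible growth `γ^{(2-n)h}` of (2.42) for `n ≥ 3`).  A predicate, never asserted.
[cite: BenfattoGiulianiMastropietro2006, §2.3 (2.36)] -/
def IncrementBounds (β U : ℝ) (C : ℕ → ℝ) (w : ℤ → ℝ) (hβ : ℤ) (E : ℤ → ℝ × (Fin 2 → ℝ) → ℂ) : Prop :=
  ∀ h : ℤ, hβ ≤ h → h ≤ 0 →
    (∀ k₀ ∈ matsubaraSet β, ∀ k : Fin 2 → ℝ,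
      ‖E h (k₀, k) - E (h - 1) (k₀, k)‖ ≤ C 0 * |U| * w h * (4 : ℝ) ^ (2 * h)) ∧
    (∀ (a b : ℕ), 1 ≤ a + b → ∀ (i : Fin b → Fin 2), ∀ k₀ ∈ matsubaraSet β, ∀ k : Fin 2 → ℝ,
      ‖mixedPartial i (fun k' => bgmTimeDiffIter β a (fun q => E h q - E (h - 1) q) (k₀, k')) k‖ ≤
        C (a + b) * |U| ^ 2 * w h * (4 : ℝ) ^ ((2 - ((a + b : ℕ) : ℤ)) * h))

/-- The tree's `BGMSmoothness` IS smoothness, periodicity and `IncrementBounds` with the printed weight `w(h) = |h|`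
(so nothing of BGM06 is restated here: the KL form is the same predicate at `w ≡ 1`).
[cite: BenfattoGiulianiMastropietro2006, §2.3 (2.36)] -/
theorem bgmSmoothness_iff (β U : ℝ) (C : ℕ → ℝ) (hβ : ℤ) (E : ℤ → ℝ × (Fin 2 → ℝ) → ℂ) :
    BGMSmoothness β U C hβ E ↔
      (∀ (h : ℤ) (k₀ : ℝ) (m : ℕ), ContDiff ℝ m (fun k : Fin 2 → ℝ => E h (k₀, k))) ∧
      (∀ (h : ℤ) (k₀ : ℝ) (k : Fin 2 → ℝ) (z : Fin 2 → ℤ),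
          E h (k₀, k + fun i => 2 * π * (z i : ℝ)) = E h (k₀, k)) ∧
      IncrementBounds β U C (fun h => |(h : ℝ)|) hβ E :=
  Iff.rfl

/-! ### The effective dispersion `ε_h` on Euclidean momentum space -/

/-- **`ε_h` on `Momentum`**: BGM's effective dispersion `ε_h(k⃗) = Re ½[E_h(π/β,k⃗) + E_h(-π/β,k⃗)]` ((2.36c), the
tree's `bgmEffDisp β E h`) read on `Momentum = EuclideanSpace ℝ (Fin 2)`, where `gradient`, `FermiRG.hessQuad` and
`FermiRG.GeomConstants` live. [cite: BenfattoGiulianiMastropietro2006, §2.4 (2.36c)] -/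
def effDisp (β : ℝ) (E : ℤ → ℝ × (Fin 2 → ℝ) → ℂ) (h : ℤ) : Momentum → ℝ :=
  fun k => bgmEffDisp β E h (WithLp.ofLp k)

/-- **The scale-`h` level function `e_h = ε_h - μ`**; its zero set `FermiRG.fermiSurface (effLevel β μ E h)` is BGM's
scale-`h` Fermi curve `Σ^{(h)}`, its level sets the curves `Σ^{(h)}(e)` of Lemma 2.1.
[cite: BenfattoGiulianiMastropietro2006, §2.4 Lemma 2.1] -/
def effLevel (β μ : ℝ) (E : ℤ → ℝ × (Fin 2 → ℝ) → ℂ) (h : ℤ) : Momentum → ℝ :=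
  fun k => effDisp β E h k - μ

/-- `e_h = ε_h - μ` pointwise. -/
@[simp] theorem effLevel_apply (β μ : ℝ) (E : ℤ → ℝ × (Fin 2 → ℝ) → ℂ) (h : ℤ) (k : Momentum) :
    effLevel β μ E h k = effDisp β E h k - μ := rfl

/-- Under the initial condition `E_0 ≡ ε` (the tree's `BGMInitial`) the scale-`0` effective dispersion is the free band
on `Momentum`: `ε_0 = squareDispersion 1 0`. -/
theorem effDisp_zero_of_initial {E : ℤ → ℝ × (Fin 2 → ℝ) → ℂ} (hE : BGMInitial E) (β : ℝ) :
    effDisp β E 0 = fun q : Momentum => squareDispersion 1 0 q := by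
  funext q
  have h1 : ∀ k₀ : ℝ, E 0 (k₀, WithLp.ofLp q) = ((sqDispersion (WithLp.ofLp q) : ℝ) : ℂ) :=
    fun k₀ => hE (k₀, WithLp.ofLp q)
  simp only [effDisp, bgmEffDisp, h1, ← Complex.ofReal_add]
  rw [show (2 : ℂ) = ((2 : ℝ) : ℂ) by norm_num, ← Complex.ofReal_div, Complex.ofReal_re]
  simp only [sqDispersion, squareDispersion]
  ring

/-- … hence the scale-`0` level function is the free-band level function of the Fermi-surface files
(`KLProgrammeFermiSurfaceFST2*`: `fun q ↦ squareDispersion 1 0 q - μ`). -/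
theorem effLevel_zero_of_initial {E : ℤ → ℝ × (Fin 2 → ℝ) → ℂ} (hE : BGMInitial E) (β μ : ℝ) :
    effLevel β μ E 0 = fun q : Momentum => squareDispersion 1 0 q - μ := by
  funext q
  rw [effLevel_apply, effDisp_zero_of_initial hE]

/-- **(I_h), layer (β) — per-scale bounds of the effective dispersion, operator-norm form, scale weight `w`**: every
`ε_h` (`h ≤ 0`) is `C²` on `Momentum`, and for `h_β ≤ h ≤ 0` and every `p`: `|ε_h(p) - ε_{h-1}(p)| ≤ A₀|U|w(h)γ^{2h}`,
`‖D(ε_h - ε_{h-1})(p)‖ ≤ A₁U²w(h)γ^h`, `‖D²(ε_h - ε_{h-1})(p)‖ ≤ A₂U²w(h)` — the `a = 0` clauses of (2.36) at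
`k₀ = ±π/β`, averaged ((2.36c)) and read in the Euclidean norm (transport = absolute constants); summed over the
scales they are BGM's (2.41a) (`KLProgrammeDispersionFlowEnvelope.cumulative_bounds_of_increments`).  KL form: `w ≡ 1`.
[cite: BenfattoGiulianiMastropietro2006, §2.4 (2.36c)–(2.41a)] -/
def EffectiveStepBounds (β U A₀ A₁ A₂ : ℝ) (w : ℤ → ℝ) (hβ : ℤ) (E : ℤ → ℝ × (Fin 2 → ℝ) → ℂ) : Prop :=
  (∀ h : ℤ, h ≤ 0 → ContDiff ℝ 2 (effDisp β E h)) ∧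
  ∀ h : ℤ, hβ ≤ h → h ≤ 0 → ∀ p : Momentum,
    |effDisp β E h p - effDisp β E (h - 1) p| ≤ A₀ * |U| * w h * (4 : ℝ) ^ (2 * h) ∧
    ‖iteratedFDeriv ℝ 1 (fun q => effDisp β E h q - effDisp β E (h - 1) q) p‖ ≤
      A₁ * U ^ 2 * w h * (4 : ℝ) ^ h ∧
    ‖iteratedFDeriv ℝ 2 (fun q => effDisp β E h q - effDisp β E (h - 1) q) p‖ ≤ A₂ * U ^ 2 * w h

/-- **(I_h), layer (γ) — the TANGENTIAL FLOOR** (the load-bearing novelty of the KL regime; DECOMP App. C, P2-C4B §1 R-b,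
§5): for every scale `h_β ≤ h ≤ 0`, every point `p` of the tube `{|ε_0 - μ| ≤ ē}` and every vector `t` tangent at `p`
to the scale-`h` level curve through `p` (`⟪∇e_h(p), t⟫ = 0`), the Hessian form of the CUMULATIVE correction obeys
`(t, (ε_h - ε_0)''(p) t) ≥ -bU²|t|²`, `b` independent of `h`.  (Two-sidedly the same form is only `O(U²|h|)`: at a
corner `k*` it is `+2Bα²U²|h| log γ + O(U²)`, App. C (iv) — the clause says exactly «the log has the convexity-ENHANCING
sign», which is why the lower curvature end `κ₀ - CU²` does not depend on `c`.)  Tangent directions only: the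
transversal / frequency second derivatives of a `d = 2` self-energy carry logarithms of their own (FST II). -/
def TangentialFloor (β U μ b ebar : ℝ) (hβ : ℤ) (E : ℤ → ℝ × (Fin 2 → ℝ) → ℂ) : Prop :=
  ∀ h : ℤ, hβ ≤ h → h ≤ 0 → ∀ p : Momentum, |effLevel β μ E 0 p| ≤ ebar → ∀ t : Momentum,
    inner ℝ (gradient (effLevel β μ E h) p) t = 0 →
      -(b * U ^ 2) * ‖t‖ ^ 2 ≤ hessQuad (fun q => effDisp β E h q - effDisp β E 0 q) p t

/-- **The constants of (I_h)**: `C n` for the `E_h`-clauses (shape of (2.36)), `A₀, A₁, A₂` for the `ε_h`-clauses, the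
floor `b` and the tube half-width `ē`.  Data only. -/
structure KLFlowConstants where
  /-- the constants `Cₙ` of the `E_h`-clauses (shape of BGM06 (2.36)) -/
  C : ℕ → ℝ
  /-- zeroth order: `|ε_h - ε_{h-1}| ≤ A₀|U|w(h)γ^{2h}` -/
  A₀ : ℝ
  /-- first order: `‖D(ε_h - ε_{h-1})‖ ≤ A₁U²w(h)γ^h` -/
  A₁ : ℝ
  /-- second order: `‖D²(ε_h - ε_{h-1})‖ ≤ A₂U²w(h)` (no gain) -/
  A₂ : ℝ
  /-- the tangential floor: `(t, (ε_h - ε_0)'' t) ≥ -bU²|t|²` -/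
  b : ℝ
  /-- half-width `ē` of the tube `{|ε_0 - μ| ≤ ē}` on which the floor is required (Lemma 2.1's `ē`) -/
  ebar : ℝ

/-- **(I_h) — the dispersion-flow invariant with scale weight `w`, down to scale `h_β`**: every `E_h(k₀, ·)` smooth and
`2π`-periodic (as in `BGMSmoothness`), the weighted increment bounds for `E_h` and for `ε_h`, and the tangential floor.
`w = |·|` is BGM's regime (there the floor follows from the two-sided smallness `C₂c₀²`); `w ≡ 1` is the KL regime of
crux C4a, where the floor is load-bearing.  BGM's symmetries (2.36a) and the initial condition are the tree's
`BGMSymmetry E`, `BGMInitial E`, taken alongside (as the typed Lemmas 2.1–2.3 do).  A predicate, never asserted. -/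
def DispersionFlow (β U μ : ℝ) (κ : KLFlowConstants) (w : ℤ → ℝ) (hβ : ℤ) (E : ℤ → ℝ × (Fin 2 → ℝ) → ℂ) : Prop :=
  (∀ (h : ℤ) (k₀ : ℝ) (m : ℕ), ContDiff ℝ m (fun k : Fin 2 → ℝ => E h (k₀, k))) ∧
  (∀ (h : ℤ) (k₀ : ℝ) (k : Fin 2 → ℝ) (z : Fin 2 → ℤ),
      E h (k₀, k + fun i => 2 * π * (z i : ℝ)) = E h (k₀, k)) ∧
  IncrementBounds β U κ.C w hβ E ∧
  EffectiveStepBounds β U κ.A₀ κ.A₁ κ.A₂ w hβ E ∧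
  TangentialFloor β U μ κ.b κ.ebar hβ E

/-- **The KL-regime invariant (I_h)** of DECOMP C4a / P2-C4B §5: `DispersionFlow` at the constant weight `w ≡ 1`. -/
abbrev KLDispersionFlow (β U μ : ℝ) (κ : KLFlowConstants) (hβ : ℤ) (E : ℤ → ℝ × (Fin 2 → ℝ) → ℂ) : Prop :=
  DispersionFlow β U μ κ (fun _ => 1) hβ E

/-- **The Kohn–Luttinger regime at scale `h`**: `U²|h| log γ ≤ c` (`γ = 4`).  With `γ^{h_β}e₀ ≈ π/β` this is
`β ≲ e^{c/U²}`, the `β`-range of crux K3; under it every cumulative `O(U²|h|)` quantity of (I_h) is `≤ (c/log 4)·O(1)` —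
bounded, and small if `c` is chosen small (the leaf asks only for SOME `c > 0`). -/
def IsKLRegime (U c : ℝ) (h : ℤ) : Prop := U ^ 2 * |(h : ℝ)| * Real.log 4 ≤ c

/-- In the KL regime the second-order cumulative size `A₂U²|h|` is at most `A₂c/log 4`. -/
theorem IsKLRegime.mul_le {U c : ℝ} {h : ℤ} (hr : IsKLRegime U c h) {A₂ : ℝ} (hA₂ : 0 ≤ A₂) :
    A₂ * U ^ 2 * |(h : ℝ)| ≤ A₂ * c / Real.log 4 := by
  have hlog : 0 < Real.log 4 := Real.log_pos (by norm_num)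
  unfold IsKLRegime at hr
  rw [le_div_iff₀ hlog]
  calc A₂ * U ^ 2 * |(h : ℝ)| * Real.log 4 = A₂ * (U ^ 2 * |(h : ℝ)| * Real.log 4) := by ring
    _ ≤ A₂ * c := mul_le_mul_of_nonneg_left hr hA₂

/-! ### The counterterm frame of the model-bound carrier (eng's D1): `e_K = ε - μ - K` -/

/-- **The renormalised band of the frame `K` on `Momentum`**: `e_K(q) = ε(q) - μ - K(q)` — the continuum function whose
restriction to the torus momenta `2πk⃗/L` is the tree's `nambuXiCT L μ K` (the band in the propagators and cutoffs of
`hubbardEffectiveActionCT … K Λ`, hence of D1's `klEffectiveAction`).  In the counterterm scheme the dispersion flow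
down to `h_β` IS the frame exhibited for `β`; its zero set is the interacting Fermi curve held fixed.
[cite: FeldmanSalmhoferTrubowitz1996, §1 Discussion (E = e + K)] -/
def frameLevel (μ : ℝ) (K : TrigPolyC4v) : Momentum → ℝ :=
  fun q => squareDispersion 1 0 q - μ - K.eval (WithLp.ofLp q)

/-- The frame correction on `Momentum`, `D_K(q) = -K(q)`, so that `e_K = (ε - μ) + D_K`. -/
def frameShift (K : TrigPolyC4v) : Momentum → ℝ := fun q => -K.eval (WithLp.ofLp q)

/-- `e_K = (ε - μ) + D_K` as functions on `Momentum`. -/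
theorem frameLevel_eq_add (μ : ℝ) (K : TrigPolyC4v) :
    frameLevel μ K = (fun q : Momentum => squareDispersion 1 0 q - μ) + frameShift K := by
  funext q
  simp only [frameLevel, frameShift, Pi.add_apply]
  ring

/-- **(I_h) in the frame, cumulative form at `h = h_β`** (`D = -K`): `K` is `C²` on `Momentum` (automatic for a
trigonometric polynomial; carried as a clause so that consumers need not re-derive it), `|K| ≤ a₀`, `‖∇K‖ ≤ a₁`, all
derivatives of `K` of order `≤ 2` bounded by `A` (in the KL regime `a₀ = O(|U|)`, `a₁ = O(U²)` uniformly in `β`, while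
`A = O(U²|h_β|) ≤ O(c)` may be large), and the tangential floor: along the level sets of `e_K` inside the tube
`{|ε - μ| < ē}`, `(t, (-K)''t) ≥ -b|t|²`. -/
def FrameGeometry (a₀ a₁ A b ebar μ : ℝ) (K : TrigPolyC4v) : Prop :=
  ContDiff ℝ 2 (frameShift K) ∧
  (∀ p : Momentum, |frameShift K p| ≤ a₀) ∧
  (∀ p : Momentum, ‖fderiv ℝ (frameShift K) p‖ ≤ a₁) ∧
  (∀ p : Momentum, ∀ j ≤ 2, ‖iteratedFDeriv ℝ j (frameShift K) p‖ ≤ A) ∧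
  ∀ p : Momentum, |squareDispersion 1 0 p - μ| < ebar → ∀ t : Momentum,
    inner ℝ (gradient (frameLevel μ K) p) t = 0 → -b * ‖t‖ ^ 2 ≤ hessQuad (frameShift K) p t

/-! ### The shapes of K3's child 2 in the two schemes -/

/-- **SHAPE of child 2, BGM scheme** (DECOMP v7 §8(h) 3), over an ABSTRACT model map `Efam β L U μ` = the BGM dispersion
family `(E_h)_{h ≤ 0}` of the Hubbard torus `hubbardTorusWith 2 L 1 U μ` built by (2.23) from the local quadratic part
of the scale-`h` effective potential (a definition the BGM-scheme engine owes; NOT in the tree): there are `U₀, c > 0`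
and constants `κ` such that for every doping `δ ∈ [0.10, 0.35]`, `0 < U ≤ U₀`, `0 < β ≤ e^{c/U²}`, every side `L` and
every scale `h ≤ 0` in the KL regime `U²|h| log γ ≤ c`, the family satisfies (I_h) (`w ≡ 1`) down to `h`, uniformly
in `L`.  The day that map lands, child 2 (BGM scheme) is this `Prop` at it, verbatim. -/
def KLRegimeDispersionFlowOf (Efam : ℝ → ℕ → ℝ → ℝ → (ℤ → ℝ × (Fin 2 → ℝ) → ℂ)) : Prop :=
  ∃ U₀ c : ℝ, 0 < U₀ ∧ 0 < c ∧ ∃ κ : KLFlowConstants, 0 < κ.ebar ∧ 0 ≤ κ.b ∧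
    ∀ δ ∈ Set.Icc (0.10 : ℝ) 0.35, ∀ U β : ℝ, 0 < U → U ≤ U₀ → 0 < β → β ≤ Real.exp (c / U ^ 2) →
      ∀ (L : ℕ) (h : ℤ), h ≤ 0 → IsKLRegime U c h →
        KLDispersionFlow β U (chemicalPotentialOfDensity (squareDispersion 1 0) (1 - δ)) κ h
          (Efam β L U (chemicalPotentialOfDensity (squareDispersion 1 0) (1 - δ)))

/-- **SHAPE of child 2, counterterm scheme** (the cell's model-bound carrier, W-004: eng's D1 `klEffectiveAction L M β U
μ K e₀ n` in a `C₄ᵥ` frame `K`), over an ABSTRACT admissibility predicate `Adm β L U μ K` = "`K` is a frame the engine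
may use at these data" (the renormalisation condition tying `K` to the model's self-energy `klSelfEnergy`, owed by the
engine together with its localisation operator; without it the statement would be vacuous at `K = 0`): there are
`U₀, c > 0` and `a₀, a₁, A, b ≥ 0`, `ē > 0` such that for every `δ ∈ [0.10, 0.35]`, `0 < U ≤ U₀`, `0 < β ≤ e^{c/U²}`,
every `L` and every ADMISSIBLE frame `K`: `FrameGeometry (a₀U) (a₁U²) (A·c) (bU²) ē μ(δ) K` — the cumulative (I_h)
with `β`-uniform zeroth/first-order sizes and floor, the second-order size bounded by the regime constant only. -/
def KLRegimeFrameGeometryOf (Adm : ℝ → ℕ → ℝ → ℝ → TrigPolyC4v → Prop) : Prop :=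
  ∃ U₀ c : ℝ, 0 < U₀ ∧ 0 < c ∧ ∃ a₀ a₁ A b ebar : ℝ, 0 ≤ a₀ ∧ 0 ≤ a₁ ∧ 0 ≤ A ∧ 0 ≤ b ∧ 0 < ebar ∧
    ∀ δ ∈ Set.Icc (0.10 : ℝ) 0.35, ∀ U β : ℝ, 0 < U → U ≤ U₀ → 0 < β → β ≤ Real.exp (c / U ^ 2) →
      ∀ (L : ℕ) (K : TrigPolyC4v), Adm β L U (chemicalPotentialOfDensity (squareDispersion 1 0) (1 - δ)) K →
        FrameGeometry (a₀ * U) (a₁ * U ^ 2) (A * c) (b * U ^ 2) ebar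
          (chemicalPotentialOfDensity (squareDispersion 1 0) (1 - δ)) K

end Summit.HubbardSuperconductivity.HubbardSuperconductivity.Theorems.DispersionFlow

end
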